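import Literature.Computability.AlgebraicComplexity.MS2001StableObstructionMultiplicityAllFields
import Literature.Computability.AlgebraicComplexity.BI17PowerSumStabilizerProofs
import Literature.Computability.AlgebraicComplexity.BI17ChowPowerSumPolystableProofs
import Literature.Computability.AlgebraicComplexity.PowerSumPolystableAllFields
import Literature.Computability.AlgebraicComplexity.ApolarityFischerPairing
import HarnessLib

/-!
# GCT I Thm. 5.1 at work on the pair (Fermat, Chow monomial): `x₁ᵐ + ⋯ + x_mᵐ ∉ Δ[x₁ ⋯ x_m]`
# via the obstruction `W = Sym^{2m}` (Mulmuley–Sohoni 2001, §5.2 method; objects of BI 2017 §2.1)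

Topic `Literature/Computability/AlgebraicComplexity`; THEOREMS ONLY (no definition, no named fact;
D-0026). Cell `val-lit` (D-0074 GROUP L), seat `val-lit-t01` (row MS2001-A), x-row by-product.

K. D. Mulmuley, M. Sohoni, *Geometric complexity theory I*, SIAM J. Comput. 31 (2001), Thm. 5.1
(AV p. 20, all.txt L1365–1372; tree: `MS2001_thm_5_1`, PROVED as `MS2001_thm_5_1_holds` /
`MS2001_thm_5_1_complex`): for `f` stable with stabilizer `H ⊆ G = SL(V)` and `g` with stabilizer
`Q`, "`W` is an obstruction for `(f, g)` if the multiplicity of the trivial `H`-representation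
within `W` exceeds that of the trivial `Q`-representation", whence `f ∉ Δ[g]`; and §5.2 after the
theorem (L1486–1490): "To use the obstruction criterion in this theorem effectively, one needs an
explicit formula for the dimension of the trivial `H` (or `Q`) representation within a `G`-module
`W`." MS's worked instance is Example 5.2.1, `(perm_d, det_d)` with `W = Sym^{ad}(X)` (tree:
`MS2001Example521.lean`). THIS FILE runs the same recipe (ours) on the second pair of forms whose
stabilizers the tree knows, Bürgisser–Ikenmeyer 2017, Prop. 2.4 (tree theorems
`exists_perm_diagonal_of_mem_linStabilizer_prodX`, `exists_perm_diagonal_of_mem_linStabilizer_psum`):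

* `g = x₁ ⋯ x_m` (the Chow monomial; `Δ_m[x₁⋯x_m] = Ch_m(ℂᵐ)`, the Chow variety of products of `m`
  linear forms — Landsberg 2017, §7.2: "when `dim W ≥ n`, it is the orbit closure
  `\overline{GL(W)·[x₁⋯x_n]}`"; it is closed already as a set of products, ibid. Exercise 3.1.4.2),
  stabilizer `Q = SL ∩ (T ⋊ 𝔖_m)` ("generated by the permutation matrices and the diagonal matrices
  with determinant one", BI 2017 Prop. 2.4(1));
* `f = x₁ᵐ + ⋯ + x_mᵐ` (the Fermat / power sum of degree `m` in `m` variables; `Δ_m[f]` is the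
  `m`-th secant variety of the Veronese, Landsberg 2017 §8.12.1), stable for `m ≥ 2` (BI 2017
  Cor. 2.9: tree `isPolystable_sum_X_pow`, and over every algebraically closed field of
  characteristic `0`, `isPolystable_sum_X_pow_of_isAlgClosed`), stabilizer `H = SL ∩ (μ_m ≀ 𝔖_m)`
  ("generated by the permutation matrices and the diagonal matrices `diag(t)` with `tᵢᵐ = 1`", BI
  2017 Prop. 2.4(2), `m ≥ 3`; Landsberg 2017 Prop. 8.12.1.1).

PROVED here, for `W = Sym^r`:

* **(Q)** `fixedForms_slSubgroup_prodX_eq`: `W^Q = k · (x₁⋯x_m)^c` in degree `r = mc` and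
  `fixedForms_slSubgroup_prodX_eq_bot_of_not_dvd`: `W^Q = 0` if `m ∤ r` — over EVERY infinite field
  (torus weights: a monomial `x^μ` fixed by all `diag(t)`, `∏ t = 1`, has constant exponent vector;
  `coeff_linSubst_diagonal`); `finrank … = 1`.
* **(H)** `pow_sum_X_pow_mem_fixedForms`, `sum_X_pow_mul_mem_fixedForms` (`fᶜ` and `x₁^{mc} + ⋯ + x_m^{mc}`
  lie in `W^H`, `m ≥ 3`, characteristic `0`, by BI 2017 Prop. 2.4(2)),
  `linearIndependent_pow_sum_X_pow` (evaluate at `e₁` and at `(1,…,1)`: `mᶜ ≠ m` for `c ≥ 2`), hence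
  `two_le_finrank_fixedForms_slSubgroup_sum_X_pow` (`2 ≤ dim W^H` in degree `mc`, `c ≥ 2`).
* **(C)** `MS2001_thm_5_1_powerSum_chow_obstruction`: `dim W^Q < dim W^H` for `W = Sym^{mc}`, `m ≥ 3`,
  `c ≥ 2` — `W` is an obstruction for `(f, g)` in the sense of Thm. 5.1 — and the separation
  **`sum_X_pow_not_mem_orbitClosure_prod_X`** (every algebraically closed field of characteristic `0`,
  `ℂ` included, via `MS2001_thm_5_1_holds`): `x₁ᵐ + ⋯ + x_mᵐ ∉ Δ[x₁⋯x_m] = Ch_m`, `m ≥ 3`.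
* **(§4, sharpness)** `sum_X_sq_mem_glOrbit_prod_X` (`x² + y² = (x+iy)(x−iy) ∈ GL₂·(xy)` whenever
  `i² = −1`, `2 ≠ 0`) and `sum_X_sq_mem_orbitClosure_prod_X` (`x² + y² ∈ Ch₂` over every
  algebraically closed field of characteristic `≠ 2`): `m ≥ 3` cannot be lowered.
* **(§5, every field of characteristic `0`)** `sum_X_pow_not_mem_orbitClosure_prod_X_of_charZero`:
  the separation over every field of characteristic `0`, by base change `ℚ ⊆ F`, `ℚ ⊆ ℂ`
  (`ZariskiClosureBaseChange.lean`), as t02 g9's `MS2001_example_5_2_1_charZero`.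

Honest framing: the separation is classical (for `m ≥ 3` the Fermat hypersurface is smooth —
Landsberg 2017 §8.12.1: "the zero set is smooth" — while `Ch_m` consists of the completely reducible
forms, ibid. Exercise 3.1.4.2, whose zero sets are singular along the pairwise intersections of the
factor hyperplanes); for `m = 2` it fails (`x² + y² = (x+iy)(x−iy) ∈ Ch₂`, and indeed
`Stab_{SL₂}(x²+y²) = O₂` has a one-dimensional invariant space in `Sym⁴`). What is recorded is an
OBSTRUCTION-THEORETIC proof in the sense of GCT I Thm. 5.1 — a method validation at a known
separation, on the toy pair (power sums vs. the Chow variety) of the cell's DIP 2020 row. VP ≠ VNP is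
NOT proved and nothing here bears on it.

## References

* [MulmuleySohoniSIAM2001] K. D. Mulmuley, M. Sohoni, *Geometric complexity theory I*, SIAM J.
  Comput. 31 (2001) 496–526; AV Thm. 5.1 p. 20 (all.txt L1365–1390), §5.2 p. 21 (L1486–1490),
  §5.2.1 Example 1 pp. 21–22 (the template).
* [BurgisserIkenmeyer2017] P. Bürgisser, C. Ikenmeyer, *Fundamental invariants of orbit closures*,
  J. Algebra 477 (2017) 390–434 = arXiv:1511.02927, §2.1 Prop. 2.4 (1), (2) (stabilizers of
  `X₁⋯X_m` and `X₁^D + ⋯ + X_m^D`), Cor. 2.9 (both polystable).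
* [Landsberg2017] J. M. Landsberg, *Geometry and Complexity Theory*, CUP (2017), §3.1.4 Exercise
  3.1.4.2 (the Chow variety needs no closure), §7.2 (`Ch_n(W) = \overline{GL(W)·[x₁⋯x_n]}` for
  `dim W ≥ n`), §8.12.1 (the Fermat; Prop. 8.12.1.1, its stabilizer).

## Design

`namespace Literature.Computability.AlgebraicComplexity`, helpers in `MS2001PowerSumChow`. The forms
are written inline, `∑ i : Fin m, X i ^ m` and `∏ i : Fin m, X i : MvPolynomial (Fin m) k`, as in the BI
2017 files. Field universe `Type` (as in `PowerSumPolystableAllFields.lean` and the typed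
`MS2001_thm_5_1`). Standard axioms only.
-/

noncomputable section

open MvPolynomial Matrix Finset

namespace Literature.Computability.AlgebraicComplexity

namespace MS2001PowerSumChow

variable {k : Type} [Field k] {m : ℕ}

/-! ## §1 (Q) The Chow monomial side: torus weights -/

/-- A diagonal substitution rescales the Chow monomial: `diag(t) · (x₁⋯x_m) = (∏ tᵢ) · x₁⋯x_m`
(so `diag(t) ∈ Stab(x₁⋯x_m)` iff `∏ tᵢ = 1`: BI 2017 Prop. 2.4(1), the easy inclusion).
[cite: BurgisserIkenmeyer2017, Prop. 2.4(1)] -/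
theorem linSubst_diagonal_prod_X (t : Fin m → k) :
    linSubst (Fin m) k (Matrix.diagonal t) (∏ i : Fin m, (X i : MvPolynomial (Fin m) k)) =
      (∏ i, t i) • ∏ i : Fin m, (X i : MvPolynomial (Fin m) k) := by
  rw [map_prod]
  simp_rw [Grenet.linSubst_diagonal_X, smul_eq_C_mul]
  rw [Finset.prod_mul_distrib, ← map_prod]

/-- A product over `Fin m` of a function equal to `1` off `{i, j}` (`i ≠ j`). [folklore] -/
private theorem prod_eq_mul_of_eq_one_off {f : Fin m → k} {i j : Fin m} (hij : i ≠ j)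
    (h : ∀ l, l ≠ i → l ≠ j → f l = 1) : ∏ l, f l = f i * f j := by
  classical
  rw [← Finset.prod_pair hij]
  refine (Finset.prod_subset (Finset.subset_univ _) fun l _ hl => h l ?_ ?_).symm
  · exact fun e => hl (by simp [e])
  · exact fun e => hl (by simp [e])

/-- **Torus weights.** If a polynomial `p` is fixed by every determinant-one substitution fixing
`x₁⋯x_m` (over an infinite field), then every monomial in its support has a CONSTANT exponent
vector: for `μ j < μ i` the coefficient of `x^μ` vanishes (the torus elements
`diag(1,…,s,…,s⁻¹,…,1)` multiply it by `s^{μᵢ − μⱼ} ≠ 1` for suitable `s`). The computation behind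
"the multiplicity of the trivial `Q`-module" for `Q = SL ∩ Stab(x₁⋯x_m)` (MS 2001 §5.2: "one needs
an explicit formula for the dimension of the trivial … `Q` representation within a `G`-module `W`").
[cite: MulmuleySohoniSIAM2001, §5.2 (AV p.21, all.txt L1486–1490)] [cite: BurgisserIkenmeyer2017, Prop. 2.4(1)] -/
theorem coeff_eq_zero_of_mem_fixedForms_prodX [Infinite k] {p : MvPolynomial (Fin m) k} {r : ℕ}
    (hp : p ∈ fixedForms (slSubgroup (Fin m) k) (∏ i : Fin m, (X i : MvPolynomial (Fin m) k)) r)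
    {μ : Fin m →₀ ℕ} {i j : Fin m} (hμ : μ j < μ i) : coeff μ p = 0 := by
  classical
  have hij : i ≠ j := by rintro rfl; exact lt_irrefl _ hμ
  obtain ⟨-, hfix⟩ := mem_fixedForms_iff.mp hp
  -- for every `s ≠ 0`, the torus element `t = diag(1,…,s,…,s⁻¹,…,1)` gives `(s^{μ i} s^{-μ j} - 1) · coeff = 0`
  have key : ∀ s : k, s ≠ 0 → (s ^ μ i * s⁻¹ ^ μ j - 1) * coeff μ p = 0 := by
    intro s hs
    set t : Fin m → k := Function.update (Function.update 1 i s) j s⁻¹ with ht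
    have hti : t i = s := by
      rw [ht, Function.update_of_ne hij, Function.update_self]
    have htj : t j = s⁻¹ := by rw [ht, Function.update_self]
    have hto : ∀ l, l ≠ i → l ≠ j → t l = 1 := by
      intro l hli hlj
      rw [ht, Function.update_of_ne hlj, Function.update_of_ne hli, Pi.one_apply]
    have hprod : ∏ l, t l = 1 := by
      rw [prod_eq_mul_of_eq_one_off hij hto, hti, htj, mul_inv_cancel₀ hs]
    have hdet : (Matrix.diagonal t).det = 1 := by rw [Matrix.det_diagonal, hprod]
    let γ : GL (Fin m) k := Matrix.SpecialLinearGroup.toGL ⟨Matrix.diagonal t, hdet⟩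
    have hγcoe : ((γ : GL (Fin m) k) : Matrix (Fin m) (Fin m) k) = Matrix.diagonal t := rfl
    have hγsl : γ ∈ slSubgroup (Fin m) k := ⟨_, rfl⟩
    have hγg : linSubstRep (Fin m) k γ (∏ i : Fin m, (X i : MvPolynomial (Fin m) k)) =
        ∏ i : Fin m, (X i : MvPolynomial (Fin m) k) := by
      rw [linSubstRep_apply, hγcoe, linSubst_diagonal_prod_X, hprod, one_smul]
    have hγp := hfix γ hγsl hγg
    rw [linSubstRep_apply, hγcoe] at hγp
    have hc := congrArg (coeff μ) hγp
    rw [coeff_linSubst_diagonal] at hc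
    -- the weight `∏_{l ∈ supp μ} t_l^{μ l} = s^{μ i} (s⁻¹)^{μ j}`
    have hw : (∏ l ∈ μ.support, t l ^ μ l) = s ^ μ i * s⁻¹ ^ μ j := by
      rw [Finset.prod_subset (Finset.subset_univ μ.support) (fun l _ hl => by
        rw [Finsupp.notMem_support_iff.mp hl, pow_zero])]
      rw [prod_eq_mul_of_eq_one_off (f := fun l => t l ^ μ l) hij (fun l hli hlj => by
        simp only [hto l hli hlj, one_pow]), hti, htj]
    rw [hw] at hc
    linear_combination hc
  by_contra hne
  -- then `s^{μ i - μ j} = 1` for every `s ≠ 0`: impossible in an infinite field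
  have hroot : ∀ s : k, s ≠ 0 → s ^ (μ i - μ j) = 1 := by
    intro s hs
    have h1 : s ^ μ i * s⁻¹ ^ μ j - 1 = 0 := (mul_eq_zero.mp (key s hs)).resolve_right hne
    have h2 : s ^ μ i * s⁻¹ ^ μ j = 1 := sub_eq_zero.mp h1
    have h3 : s ^ μ i = s ^ (μ i - μ j) * s ^ μ j := by
      rw [← pow_add, Nat.sub_add_cancel hμ.le]
    rw [h3, mul_assoc, ← mul_pow, mul_inv_cancel₀ hs, one_pow, mul_one] at h2
    exact h2
  set e : ℕ := μ i - μ j with he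
  have hepos : 0 < e := Nat.sub_pos_of_lt hμ
  have hR0 : (Polynomial.X ^ e - 1 : Polynomial k) = 0 := by
    apply Polynomial.eq_zero_of_infinite_isRoot
    refine ((Set.finite_singleton (0 : k)).infinite_compl).mono fun s hs => ?_
    rw [Set.mem_compl_iff, Set.mem_singleton_iff] at hs
    simp [Polynomial.IsRoot, hroot s hs]
  have := congrArg (Polynomial.eval (0 : k)) hR0
  simp [zero_pow hepos.ne'] at this

/-- Every monomial in the support of a form of `W^{SL ∩ Stab(x₁⋯x_m)}` has a constant exponent
vector. [cite: BurgisserIkenmeyer2017, Prop. 2.4(1)] -/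
theorem support_const_of_mem_fixedForms_prodX [Infinite k] {p : MvPolynomial (Fin m) k} {r : ℕ}
    (hp : p ∈ fixedForms (slSubgroup (Fin m) k) (∏ i : Fin m, (X i : MvPolynomial (Fin m) k)) r)
    {μ : Fin m →₀ ℕ} (hμ : μ ∈ p.support) (i j : Fin m) : μ i = μ j := by
  by_contra h
  rcases Nat.lt_or_gt_of_ne h with hlt | hlt
  · exact (mem_support_iff.mp hμ) (coeff_eq_zero_of_mem_fixedForms_prodX hp hlt)
  · exact (mem_support_iff.mp hμ) (coeff_eq_zero_of_mem_fixedForms_prodX hp hlt)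

/-- `(x₁⋯x_m)^c` is the monomial with constant exponent vector `c`. [folklore] -/
private theorem prod_X_pow_eq_monomial (c : ℕ) :
    (∏ i : Fin m, (X i : MvPolynomial (Fin m) k)) ^ c =
      monomial (Finsupp.equivFunOnFinite.symm fun _ : Fin m => c) 1 := by
  rw [monomial_eq, C_1, one_mul, Finsupp.prod_fintype _ _ (fun i => by rw [pow_zero]),
    ← Finset.prod_pow]
  rfl

/-- **(Q) "the multiplicity of the trivial `Q`-module in `W` is precisely one"** for
`Q = SL_m ∩ Stab(x₁⋯x_m)`, `W = Sym^{mc}`: `fixedForms (slSubgroup _ k) (x₁⋯x_m) (m c) = k ∙ (x₁⋯x_m)^c`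
(`m ≥ 1`, every infinite field) — the analogue, for the Chow monomial, of MS Example 5.2.1's
`det`-side computation. [cite: MulmuleySohoniSIAM2001, §5.2.1 Example 1 (AV p.22, all.txt L1513–1516) — the recipe]
[cite: BurgisserIkenmeyer2017, Prop. 2.4(1)] -/
theorem fixedForms_slSubgroup_prodX_eq [Infinite k] (hm : 0 < m) (c : ℕ) :
    fixedForms (slSubgroup (Fin m) k) (∏ i : Fin m, (X i : MvPolynomial (Fin m) k)) (m * c) =
      k ∙ (∏ i : Fin m, (X i : MvPolynomial (Fin m) k)) ^ c := by
  classical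
  refine le_antisymm ?_ ?_
  · intro p hp
    have hhom : p.IsHomogeneous (m * c) := (mem_fixedForms_iff.mp hp).1
    set μ₀ : Fin m →₀ ℕ := Finsupp.equivFunOnFinite.symm fun _ : Fin m => c with hμ₀
    -- the support of `p` is contained in `{μ₀}`
    have hsupp : p.support ⊆ {μ₀} := by
      intro μ hμ
      rw [Finset.mem_singleton]
      have hconst := support_const_of_mem_fixedForms_prodX hp hμ
      -- degree count: `m · μ 0 = m c`
      have hdeg := hhom.degree_eq_sum_deg_support hμ
      have hsum : ∑ l ∈ μ.support, μ l = ∑ l : Fin m, μ l :=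
        Finset.sum_subset (Finset.subset_univ _) fun l _ hl => Finsupp.notMem_support_iff.mp hl
      have i₀ : Fin m := ⟨0, hm⟩
      have hall : ∀ l, μ l = μ i₀ := fun l => hconst l i₀
      rw [hsum, Finset.sum_congr rfl (fun l _ => hall l), Finset.sum_const, Finset.card_univ,
        Fintype.card_fin, smul_eq_mul] at hdeg
      have hc : μ i₀ = c := Nat.eq_of_mul_eq_mul_left hm hdeg.symm
      ext l
      rw [hall l, hc, hμ₀]
      rfl
    rcases Finset.subset_singleton_iff.mp hsupp with h0 | h1
    · have : p = 0 := by simpa using h0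
      rw [this]; exact Submodule.zero_mem _
    · have hp' : p = coeff μ₀ p • (∏ i : Fin m, (X i : MvPolynomial (Fin m) k)) ^ c := by
        rw [prod_X_pow_eq_monomial, smul_monomial, smul_eq_mul, mul_one]
        conv_lhs => rw [p.as_sum, h1, Finset.sum_singleton]
      rw [hp']
      exact Submodule.smul_mem _ _ (Submodule.mem_span_singleton_self _)
  · rw [Submodule.span_le, Set.singleton_subset_iff]
    refine mem_fixedForms_iff.mpr ⟨?_, fun γ _ hγ => ?_⟩
    · have h1 : (∏ i : Fin m, (X i : MvPolynomial (Fin m) k)).IsHomogeneous m := by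
        have := IsHomogeneous.prod (Finset.univ : Finset (Fin m))
          (fun i => (X i : MvPolynomial (Fin m) k)) (fun _ => 1) fun i _ => isHomogeneous_X k i
        simpa using this
      exact h1.pow c
    · rw [linSubstRep_apply] at hγ ⊢
      rw [map_pow, hγ]

/-- **`dim (Sym^{mc})^Q = 1`** for `Q = SL_m ∩ Stab(x₁⋯x_m)` (`m ≥ 1`, every infinite field).
[cite: BurgisserIkenmeyer2017, Prop. 2.4(1)] [cite: MulmuleySohoniSIAM2001, §5.2.1 Example 1 (the recipe)] -/
theorem finrank_fixedForms_slSubgroup_prodX (k : Type) [Field k] [Infinite k] (hm : 0 < m) (c : ℕ) :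
    Module.finrank k (fixedForms (slSubgroup (Fin m) k)
      (∏ i : Fin m, (X i : MvPolynomial (Fin m) k)) (m * c)) = 1 := by
  rw [fixedForms_slSubgroup_prodX_eq hm]
  refine finrank_span_singleton (pow_ne_zero _ ?_)
  rw [Finset.prod_ne_zero_iff]
  exact fun i _ => X_ne_zero i

/-- **No `Q`-invariants in degrees not divisible by `m`** (`Q = SL_m ∩ Stab(x₁⋯x_m)`, `m ≥ 1`, every
infinite field). [cite: BurgisserIkenmeyer2017, Prop. 2.4(1)] -/
theorem fixedForms_slSubgroup_prodX_eq_bot_of_not_dvd [Infinite k] (hm : 0 < m) {r : ℕ}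
    (hr : ¬ m ∣ r) :
    fixedForms (slSubgroup (Fin m) k) (∏ i : Fin m, (X i : MvPolynomial (Fin m) k)) r = ⊥ := by
  classical
  rw [Submodule.eq_bot_iff]
  intro p hp
  have hhom : p.IsHomogeneous r := (mem_fixedForms_iff.mp hp).1
  by_contra hne
  obtain ⟨μ, hμ⟩ := Finset.nonempty_iff_ne_empty.mpr fun h => hne (support_eq_empty.mp h)
  have hconst := support_const_of_mem_fixedForms_prodX hp hμ
  have hdeg := hhom.degree_eq_sum_deg_support hμ
  have hsum : ∑ l ∈ μ.support, μ l = ∑ l : Fin m, μ l :=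
    Finset.sum_subset (Finset.subset_univ _) fun l _ hl => Finsupp.notMem_support_iff.mp hl
  have i₀ : Fin m := ⟨0, hm⟩
  rw [hsum, Finset.sum_congr rfl (fun l _ => hconst l i₀), Finset.sum_const, Finset.card_univ,
    Fintype.card_fin, smul_eq_mul] at hdeg
  exact hr ⟨μ i₀, hdeg⟩

/-! ## §2 (H) The Fermat side: two invariants -/

/-- **`fᶜ ∈ W^H`** for `f = x₁ᵐ + ⋯ + x_mᵐ`, `H = SL_m ∩ Stab(f)`, `W = Sym^{mc}` (any field).
[cite: MulmuleySohoniSIAM2001, §5.2.1 Example 1 (the recipe: "`perm(X)^a ∈ W` is fixed by `H`")] -/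
theorem pow_sum_X_pow_mem_fixedForms (c : ℕ) :
    (∑ i : Fin m, (X i : MvPolynomial (Fin m) k) ^ m) ^ c ∈
      fixedForms (slSubgroup (Fin m) k) (∑ i : Fin m, (X i : MvPolynomial (Fin m) k) ^ m) (m * c) := by
  refine mem_fixedForms_iff.mpr ⟨(isHomogeneous_sum_X_pow_univ m).pow c, fun γ _ hγ => ?_⟩
  rw [linSubstRep_apply] at hγ ⊢
  rw [map_pow, hγ]

/-- **`x₁^{mc} + ⋯ + x_m^{mc} ∈ W^H`** for `H = SL_m ∩ Stab(x₁ᵐ + ⋯ + x_mᵐ)`, `m ≥ 3`, characteristic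
`0`: every element of the stabilizer is `P_π · diag(t)` with `tⱼᵐ = 1` (BI 2017 Prop. 2.4(2), tree
`exists_perm_diagonal_of_mem_linStabilizer_psum`), and these fix every power sum of degree divisible
by `m`. [cite: BurgisserIkenmeyer2017, Prop. 2.4(2)] -/
theorem sum_X_pow_mul_mem_fixedForms [CharZero k] (hm : 3 ≤ m) (c : ℕ) :
    (∑ i : Fin m, (X i : MvPolynomial (Fin m) k) ^ (m * c)) ∈
      fixedForms (slSubgroup (Fin m) k) (∑ i : Fin m, (X i : MvPolynomial (Fin m) k) ^ m) (m * c) := by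
  refine mem_fixedForms_iff.mpr ⟨isHomogeneous_sum_X_pow_univ (m * c), fun γ _ hγ => ?_⟩
  obtain ⟨π, t, ht, hγM⟩ := exists_perm_diagonal_of_mem_linStabilizer_psum (by omega : 2 < m) γ
    ((mem_linStabilizer (f := ∑ i : Fin m, (X i : MvPolynomial (Fin m) k) ^ m)).mpr hγ)
  rw [linSubstRep_apply, hγM, linSubst_mul, AlgHom.comp_apply,
    linSubst_diagonal_sum_X_pow t (fun i => by rw [pow_mul, ht i, one_pow]),
    linSubst_permMatrix_sum_X_pow]

/-- Evaluating a power sum at a coordinate vector: `(∑ xᵢ^D)(e_{i₀}) = 1` (`D ≥ 1`). [folklore] -/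
private theorem eval_single_sum_X_pow (i₀ : Fin m) {D : ℕ} (hD : D ≠ 0) :
    eval (Pi.single i₀ (1 : k)) (∑ i : Fin m, (X i : MvPolynomial (Fin m) k) ^ D) = 1 := by
  rw [map_sum, Finset.sum_eq_single i₀]
  · rw [map_pow, eval_X, Pi.single_eq_same, one_pow]
  · intro l _ hl
    rw [map_pow, eval_X, Pi.single_eq_of_ne hl, zero_pow hD]
  · intro h
    exact absurd (Finset.mem_univ _) h

/-- Evaluating a power sum at `(1, …, 1)`: `(∑ xᵢ^D)(1,…,1) = m`. [folklore] -/
private theorem eval_one_sum_X_pow (D : ℕ) :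
    eval (fun _ : Fin m => (1 : k)) (∑ i : Fin m, (X i : MvPolynomial (Fin m) k) ^ D) = (m : k) := by
  rw [map_sum]
  simp

/-- **The two `H`-invariants are linearly independent** (`m ≥ 2`, `c ≥ 2`, characteristic `0`):
evaluate `s · fᶜ + t · (∑ xᵢ^{mc}) = 0` at `e₁` (`s + t = 0`) and at `(1,…,1)` (`s mᶜ + t m = 0`);
`mᶜ ≠ m`. [cite: MulmuleySohoniSIAM2001, §5.2.1 Example 1 (the recipe: "the multiplicity … exceeds one")] -/
theorem linearIndependent_pow_sum_X_pow [CharZero k] (hm : 2 ≤ m) {c : ℕ} (hc : 2 ≤ c) :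
    LinearIndependent k ![(∑ i : Fin m, (X i : MvPolynomial (Fin m) k) ^ m) ^ c,
      ∑ i : Fin m, (X i : MvPolynomial (Fin m) k) ^ (m * c)] := by
  rw [LinearIndependent.pair_iff]
  intro s t hst
  have hm0 : m ≠ 0 := by omega
  have hmc : m * c ≠ 0 := Nat.mul_ne_zero hm0 (by omega)
  have h1 := congrArg (eval (Pi.single (⟨0, by omega⟩ : Fin m) (1 : k))) hst
  rw [map_add, smul_eval, smul_eval, map_pow, eval_single_sum_X_pow _ hm0,
    eval_single_sum_X_pow _ hmc, map_zero, one_pow, mul_one, mul_one] at h1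
  have h2 := congrArg (eval fun _ : Fin m => (1 : k)) hst
  rw [map_add, smul_eval, smul_eval, map_pow, eval_one_sum_X_pow, eval_one_sum_X_pow,
    map_zero] at h2
  have ht : t = -s := by linear_combination h1
  rw [ht] at h2
  have hne : ((m : k)) ^ c - (m : k) ≠ 0 := by
    rw [sub_ne_zero, ← Nat.cast_pow, Ne, Nat.cast_inj]
    intro h
    have : m ^ 2 ≤ m ^ c := Nat.pow_le_pow_right (by omega) hc
    nlinarith
  have hs : s = 0 := by
    have : s * (((m : k)) ^ c - (m : k)) = 0 := by linear_combination h2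
    exact (mul_eq_zero.mp this).resolve_right hne
  exact ⟨hs, by rw [ht, hs, neg_zero]⟩

/-- **(H) "the multiplicity of the trivial `H`-representation in `W` exceeds one"** for
`f = x₁ᵐ + ⋯ + x_mᵐ`, `H = SL_m ∩ Stab(f)`, `W = Sym^{mc}`, `m ≥ 3`, `c ≥ 2`, characteristic `0`:
`2 ≤ finrank (fixedForms (slSubgroup _ k) f (m c))`.
[cite: MulmuleySohoniSIAM2001, §5.2.1 Example 1 (the recipe)] [cite: BurgisserIkenmeyer2017, Prop. 2.4(2)] -/
theorem two_le_finrank_fixedForms_slSubgroup_sum_X_pow (k : Type) [Field k] [CharZero k]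
    (hm : 3 ≤ m) {c : ℕ} (hc : 2 ≤ c) :
    2 ≤ Module.finrank k (fixedForms (slSubgroup (Fin m) k)
      (∑ i : Fin m, (X i : MvPolynomial (Fin m) k) ^ m) (m * c)) := by
  have hli := linearIndependent_pow_sum_X_pow (k := k) (m := m) (by omega) hc
  have hle : Submodule.span k (Set.range ![(∑ i : Fin m, (X i : MvPolynomial (Fin m) k) ^ m) ^ c,
      ∑ i : Fin m, (X i : MvPolynomial (Fin m) k) ^ (m * c)]) ≤
      fixedForms (slSubgroup (Fin m) k) (∑ i : Fin m, (X i : MvPolynomial (Fin m) k) ^ m) (m * c) := by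
    rw [Submodule.span_le]
    rintro _ ⟨i, rfl⟩
    fin_cases i
    · simpa using pow_sum_X_pow_mem_fixedForms (k := k) (m := m) c
    · simpa using sum_X_pow_mul_mem_fixedForms (k := k) hm c
  haveI : Module.Finite k ↥(homogeneousSubmodule (Fin m) k (m * c)) :=
    finite_homogeneousSubmodule _ k _
  haveI : Module.Finite k ↥(fixedForms (slSubgroup (Fin m) k)
      (∑ i : Fin m, (X i : MvPolynomial (Fin m) k) ^ m) (m * c)) :=
    Submodule.finiteDimensional_of_le (fun p hp => hp.1)
  calc 2 = Module.finrank k (Submodule.span k (Set.range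
      ![(∑ i : Fin m, (X i : MvPolynomial (Fin m) k) ^ m) ^ c,
        ∑ i : Fin m, (X i : MvPolynomial (Fin m) k) ^ (m * c)])) := by
        rw [finrank_span_eq_card hli]; simp
    _ ≤ _ := Submodule.finrank_mono hle

end MS2001PowerSumChow

open MS2001PowerSumChow

/-! ## §3 The obstruction and the separation -/

/-- **`W = Sym^{mc}` is a Thm.-5.1 obstruction for the pair `(x₁ᵐ + ⋯ + x_mᵐ, x₁⋯x_m)`** (`m ≥ 3`,
`c ≥ 2`, every field of characteristic `0`): in the typed hypothesis shape of `MS2001_thm_5_1`,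
`dim (Sym^{mc})^{SL ∩ Stab(x₁⋯x_m)} = 1 < 2 ≤ dim (Sym^{mc})^{SL ∩ Stab(x₁ᵐ+⋯+x_mᵐ)}`. OURS — the recipe of
MS 2001 §5.2 / Example 5.2.1 ("`W` is an obstruction for `(f, g)` if the multiplicity of the trivial
`H`-representation within `W` exceeds that of the trivial `Q`-representation") run on the stabilizers
of BI 2017 Prop. 2.4. [cite: MulmuleySohoniSIAM2001, Thm. 5.1 and §5.2.1 Example 1 (AV pp.20–22)]
[cite: BurgisserIkenmeyer2017, Prop. 2.4 (1), (2)] -/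
theorem MS2001_thm_5_1_powerSum_chow_obstruction (k : Type) [Field k] [CharZero k] {m : ℕ}
    (hm : 3 ≤ m) {c : ℕ} (hc : 2 ≤ c) :
    Module.finrank k (fixedForms (slSubgroup (Fin m) k)
        (∏ i : Fin m, (X i : MvPolynomial (Fin m) k)) (m * c)) <
      Module.finrank k (fixedForms (slSubgroup (Fin m) k)
        (∑ i : Fin m, (X i : MvPolynomial (Fin m) k) ^ m) (m * c)) := by
  rw [finrank_fixedForms_slSubgroup_prodX k (by omega) c]
  exact lt_of_lt_of_le one_lt_two (two_le_finrank_fixedForms_slSubgroup_sum_X_pow k hm hc)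

/-- **The Fermat is not in the Chow variety, by GCT I Thm. 5.1** — `x₁ᵐ + ⋯ + x_mᵐ ∉ Δ[x₁⋯x_m]`
(`= \overline{GL_m·(x₁⋯x_m)} = Ch_m`, Landsberg 2017 §7.2) for `m ≥ 3`, over every algebraically
closed field of characteristic `0`: the tree's theorem `MS2001_thm_5_1_holds` (GCT I Thm. 5.1,
multiplicity form) applied to the stable form `f = x₁ᵐ + ⋯ + x_mᵐ` (BI 2017 Cor. 2.9; tree
`isPolystable_sum_X_pow_of_isAlgClosed`) and the obstruction `W = Sym^{2m}`
(`MS2001_thm_5_1_powerSum_chow_obstruction`). The separation itself is classical (the Fermat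
hypersurface is smooth, Landsberg 2017 §8.12.1, while `Ch_m` is the set of completely reducible
forms, ibid. Exercise 3.1.4.2); the obstruction-theoretic proof is ours. `m ≥ 3` is sharp
(`x² + y² ∈ Ch₂`). [cite: Landsberg2017, §7.2 (Chow variety as orbit closure), Exercise 3.1.4.2, §8.12.1]
[cite: MulmuleySohoniSIAM2001, Thm. 5.1 (AV p.20, all.txt L1365)] [cite: BurgisserIkenmeyer2017, Cor. 2.9 and Prop. 2.4] -/
theorem sum_X_pow_not_mem_orbitClosure_prod_X (K : Type) [Field K] [IsAlgClosed K] [CharZero K]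
    {m : ℕ} (hm : 3 ≤ m) :
    (∑ i : Fin m, (X i : MvPolynomial (Fin m) K) ^ m) ∉
      orbitClosure (∏ i : Fin m, (X i : MvPolynomial (Fin m) K)) := by
  have hprod : (∏ i : Fin m, (X i : MvPolynomial (Fin m) K)).IsHomogeneous m := by
    have := IsHomogeneous.prod (Finset.univ : Finset (Fin m))
      (fun i => (X i : MvPolynomial (Fin m) K)) (fun _ => 1) fun i _ => isHomogeneous_X K i
    simpa using this
  have hst : IsPolystable (∑ i : Fin m, (X i : MvPolynomial (Fin m) K) ^ m) :=
    isPolystable_sum_X_pow_of_isAlgClosed hm (by exact_mod_cast (show m ≠ 0 by omega))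
      (by rw [Fintype.card_fin]; exact hm)
  exact MS2001_thm_5_1_holds K (Fin m) _ _ m (isHomogeneous_sum_X_pow_univ m) hprod hst
    ⟨m * 2, MS2001_thm_5_1_powerSum_chow_obstruction K hm le_rfl⟩

/-! ## §4 Sharpness of `m ≥ 3`: `x² + y² ∈ GL₂ · (xy) ⊆ Ch₂` -/

/-- **`m ≥ 3` is sharp: `x² + y² = (x + iy)(x − iy)` lies in the `GL₂`-ORBIT of `xy`** over every
field containing a square root `i` of `−1` in which `2 ≠ 0` (the substitution `x ↦ x + iy`,
`y ↦ x − iy` has determinant `−2i`). Landsberg 2017, §7.2: binary forms all lie in the Chow variety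
(`dim W = 2 ≤ n`: every binary form is a product of linear forms over an algebraically closed
field); here the explicit group element. [cite: Landsberg2017, §7.2 and Exercise 3.1.4.2] -/
theorem sum_X_sq_mem_glOrbit_prod_X (K : Type) [Field K] {i : K} (hi : i * i = -1)
    (h2 : (2 : K) ≠ 0) :
    (∑ j : Fin 2, (X j : MvPolynomial (Fin 2) K) ^ 2) ∈
      glOrbit (Fin 2) K (∏ j : Fin 2, (X j : MvPolynomial (Fin 2) K)) := by
  -- the substitution matrix (columns = images of `x`, `y`): `x ↦ x + i y`, `y ↦ x − i y`
  let M : Matrix (Fin 2) (Fin 2) K := !![1, 1; i, -i]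
  have hdet : M.det ≠ 0 := by
    rw [Matrix.det_fin_two_of]
    intro h
    have h' : (2 : K) * i = 0 := by linear_combination -h
    rcases mul_eq_zero.mp h' with h0 | h0
    · exact h2 h0
    · rw [h0, mul_zero] at hi
      exact one_ne_zero (neg_eq_zero.mp hi.symm)
  refine ⟨Matrix.GeneralLinearGroup.mkOfDetNeZero M hdet, ?_⟩
  have hC : (C i : MvPolynomial (Fin 2) K) * C i = -1 := by rw [← map_mul, hi, map_neg, map_one]
  change linSubstRep (Fin 2) K _ (∏ j : Fin 2, (X j : MvPolynomial (Fin 2) K)) = _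
  rw [linSubstRep_apply]
  change linSubst (Fin 2) K M _ = _
  rw [Fin.prod_univ_two, Fin.sum_univ_two, map_mul, linSubst_X, linSubst_X, Fin.sum_univ_two,
    Fin.sum_univ_two]
  simp only [M, Matrix.of_apply, Matrix.cons_val', Matrix.cons_val_zero, Matrix.cons_val_one,
    Matrix.cons_val_fin_one, Matrix.empty_val', one_smul, smul_eq_C_mul, map_neg]
  linear_combination (-(X 1 : MvPolynomial (Fin 2) K) ^ 2) * hC

/-- Hence **`x² + y² ∈ Δ[xy] = Ch₂` over every algebraically closed field of characteristic `≠ 2`**: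
the hypothesis `m ≥ 3` of `sum_X_pow_not_mem_orbitClosure_prod_X` cannot be lowered (for `m = 2`
the `SL₂`-stabilizer of `x² + y²` is the orthogonal group, BI 2017 Prop. 2.4(2) excludes `m = 2`
for this reason). [cite: Landsberg2017, §7.2] [cite: BurgisserIkenmeyer2017, Prop. 2.4 (hypothesis `m ≥ 3`)] -/
theorem sum_X_sq_mem_orbitClosure_prod_X (K : Type) [Field K] [IsAlgClosed K] (h2 : (2 : K) ≠ 0) :
    (∑ j : Fin 2, (X j : MvPolynomial (Fin 2) K) ^ 2) ∈
      orbitClosure (∏ j : Fin 2, (X j : MvPolynomial (Fin 2) K)) := by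
  obtain ⟨i, hi⟩ := IsAlgClosed.exists_eq_mul_self (-1 : K)
  exact glOrbit_subset_orbitClosure _ (sum_X_sq_mem_glOrbit_prod_X K hi.symm h2)

/-! ## §5 Every field of characteristic `0` (base change) -/

/-- The Fermat and the Chow monomial are defined over the prime field: base change fixes them.
[folklore] -/
private theorem map_sum_X_pow_eq {R S : Type*} [CommSemiring R] [CommSemiring S] (φ : R →+* S)
    (m D : ℕ) : map φ (∑ i : Fin m, (X i : MvPolynomial (Fin m) R) ^ D) =
      ∑ i : Fin m, (X i : MvPolynomial (Fin m) S) ^ D := by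
  rw [map_sum]
  simp_rw [map_pow, map_X]

/-- Base change fixes `x₁⋯x_m`. [folklore] -/
private theorem map_prod_X_eq {R S : Type*} [CommSemiring R] [CommSemiring S] (φ : R →+* S)
    (m : ℕ) : map φ (∏ i : Fin m, (X i : MvPolynomial (Fin m) R)) =
      ∏ i : Fin m, (X i : MvPolynomial (Fin m) S) := by
  rw [map_prod]
  simp_rw [map_X]

/-- **`x₁ᵐ + ⋯ + x_mᵐ ∉ Δ[x₁⋯x_m]` over EVERY field of characteristic `0`** (`m ≥ 3`; `Δ` = Zariski
closure of the `GL_m(F)`-orbit over `F`): by base change from the algebraically closed case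
`sum_X_pow_not_mem_orbitClosure_prod_X` (at `ℂ`) — both forms are defined over `ℚ`, orbit-closure
membership descends along `ℚ ⊆ F` (`mem_orbitClosure_of_map_mem`) and ascends along `ℚ ⊆ ℂ`
(`map_mem_orbitClosure_map`; `ZariskiClosureBaseChange.lean`, val-lit x3 g5), exactly as in
`MS2001_example_5_2_1_charZero` (val-lit t02 g9). A consequence of base change; no printed locator
claimed for the generalisation. [cite: Landsberg2017, §7.2, Exercise 3.1.4.2, §8.12.1]
[cite: MulmuleySohoniSIAM2001, Thm. 5.1 (AV p.20)] -/
theorem sum_X_pow_not_mem_orbitClosure_prod_X_of_charZero (F : Type*) [Field F] [CharZero F]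
    {m : ℕ} (hm : 3 ≤ m) :
    (∑ i : Fin m, (X i : MvPolynomial (Fin m) F) ^ m) ∉
      orbitClosure (∏ i : Fin m, (X i : MvPolynomial (Fin m) F)) := by
  intro h
  -- descend to `ℚ`
  have hQ : (∑ i : Fin m, (X i : MvPolynomial (Fin m) ℚ) ^ m) ∈
      orbitClosure (∏ i : Fin m, (X i : MvPolynomial (Fin m) ℚ)) := by
    refine mem_orbitClosure_of_map_mem (K := F) ?_
    rwa [map_sum_X_pow_eq, map_prod_X_eq]
  -- ascend to `ℂ` and contradict the algebraically closed case
  have hC := map_mem_orbitClosure_map (K := ℂ) hQ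
  rw [map_sum_X_pow_eq, map_prod_X_eq] at hC
  exact sum_X_pow_not_mem_orbitClosure_prod_X ℂ hm hC

end Literature.Computability.AlgebraicComplexity

end
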